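import Literature.Probability.NegativeDependence.LaplacianPseudoinverseIdentities
import HarnessLib

/-!
# Generalized Foster identities: Foster's first, second (Foster 1961) and `k`-th network theorems
# `½ Σ_{i,t} C_i r(i,t) p⁽ᵏ⁾_{it} = n − k + Σ_{i=1}^{k−1} tr(Pⁱ)` (Cinkir 2011; Bendito–Carmona–Encinas–Gesto;
# Palacios), by the trace method over the pseudo inverse of the discrete Laplacian

Sources (held, read at the page; statements VERBATIM).

Z. Cinkir, *Generalized Foster's identities*, arXiv:0907.3770 (Int. J. Quantum Chem. 111 (2011)) [Cinkir2009]
(text `paper:arxiv-0907.3770`). The setting (§3, §4): a finite connected weighted graph without self-loops and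
multiple edges («optimal vertex set»), `n` vertices, conductances `C_pq = C_qp = 1/L_k` on the edges, `C_pp = 0`,
`C_pq = 0` if `p`, `q` are not adjacent, `C_p := Σ_{q ∼ p} C_pq`; the discrete Laplacian `L = D − A` («`C_p = l_pp`
and `C_pq = −l_pq` if `p ≠ q`»), its Moore–Penrose pseudo inverse `L⁺ = (l⁺_pq)`, the resistance function `r(p,q)`,
and the voltage function `j_z(x,y)` («the voltage difference between `x` and `z`, when unit current enters at `y` and
exits at `z` (with reference voltage 0 at `z`)», §2), with (1.1b) «`2j_p(x,q) = r(p,x) + r(p,q) − r(q,x)`»; the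
transition matrix «`P = (p_it)`, `p_it = C_it/C_i`, and `Pᵏ = (p⁽ᵏ⁾_it)` the `k`-th power of `P`», with «`Σ_t p⁽ᵏ⁾_it
= 1` and `Σ_i C_i p⁽ᵏ⁾_it = C_t` for any `k ≥ 1`».
* **Lemma 3.2** «`L L⁺ = L⁺ L = I − (1/n) J`»; **Corollary 3.3** «`Σ_s l⁺_ps l_sq = −1/n` if `p ≠ q`; `(n−1)/n`
  if `p = q`»; **Lemma 3.4** «`r(p,q) = l⁺_pp − 2l⁺_pq + l⁺_qq`, for any `p, q`»; **Lemma 3.5** «`j_p(q,s) = l⁺_pp −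
  l⁺_pq − l⁺_ps + l⁺_qs`».
* **Proposition 4.1** «For any `k ≥ 1`, we have `Σ_{i,t} C_i l⁺_it p⁽ᵏ⁺¹⁾_it = 1 − tr(Pᵏ) + Σ_{i,t} C_i l⁺_it
  p⁽ᵏ⁾_it`», and the display after it: «`Σ_{i,t} C_i l⁺_it p⁽ᵏ⁾_it = k − n − Σ_{i=1}^{k−1} tr(Pⁱ) + Σ_i C_i
  l⁺_ii`» for any `k ≥ 1`.
* **Theorem 4.2** (main result) «Let `s ∈ V(Γ)`. For any `k ≥ 1`, we have `Σ_{i,t} C_i j_i(s,t) p⁽ᵏ⁾_it = n − k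
  + Σ_{i=1}^{k−1} tr(Pⁱ)`.»
* **Corollary 4.3** (the EXTENDED FOSTER IDENTITIES, «originally proved by E. Bendito, A. Carmona, A. M. Encinas
  and J. M. Gesto [BCEG]») «For any `k ≥ 1`, we have `½ Σ_{i,t} C_i r(i,t) p⁽ᵏ⁾_it = n − k + Σ_{i=1}^{k−1}
  tr(Pⁱ)`.» §1: «The Foster's first and second identities, and the third identity due to Palacios are about the
  sums of the resistance values over the graph paths consisting of one, two and three edges, respectively»; «In
  1961, Foster [Fo2] proved another identity which we call Foster's second identity».

G. Markowsky, J. L. Palacios, *Sum rules for effective resistances in infinite graphs*, J. Stat. Mech. (2017),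
arXiv:1602.06002 [MarkowskyPalacios2016] (text `paper:arxiv-1602.06002`), §2 «Foster's Theorems», for a finite
graph with unit resistances, `n` vertices, `P_ij = 1/deg(i)` if `i ∼ j`, else `0`: «R. M. Foster proved in [F1] and
[F2] the two well-known formulas for finite graphs: `Σ_{v∈G} Σ_{y∼v} R_vy = 2(n−1)` (foster1) and `Σ_{v∈G}
Σ_{x∼y∼v} R_xv/deg(·) = 2(n−2)` (foster2) […] as we have written it the resistance between each pair of points is
counted twice»; **Theorem 1** (Foster's `r`-th, «proved in [P4]») «`Σ_{i∈G} Σ_{j ∼ v_{r−1} ∼ … ∼ v_1 ∼ i}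
R_ij/(deg(v_1)deg(v_2)⋯deg(v_{r−1})) = 2(Σ_{s=0}^{r−1} tr(Pˢ) − r)`. […] Note that `tr(P⁰) = n` and `tr(P¹) = 0`,
which show that (Thm 1) reduces to (foster1) and (foster2) in the cases `r = 1, 2`.»

## What is formalised (tree vocabulary)

The network `(G, c)` of a finite connected simple graph `G` on `V` (`n = |V| ≥ 2`) with edge conductances
`c : Sym2 V → ℝ`, `c > 0` — exactly Cinkir's optimal-vertex-set graphs: `A = edgeWeight G c` is the conductance
matrix `(C_pq)` (`SpanningTreeStronglyRayleigh`), `C_p = nodeConductance A p`, `P = networkKernel A` (Levin–Peres–Wilmer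
`NetworkRandomWalk`), `L = wLaplacian A` (`WeightedMatrixForestTheorem`), `L⁺ = pinv L` (`MoorePenroseInverse`),
`r(p,q) = effectiveResistance A p q` (`EffectiveResistance`), and Cinkir's voltage function in the tree's words:
**`j_z(x,y) = 𝓡(y ↔ z) · unitVoltage A y z x`** (the voltage of the UNIT CURRENT from `y` to `z`, grounded at `z`,
read at `x`; for `y = z` both sides are `0`).

* §1 (Cinkir §3): `nodeConductance_edgeWeight_eq` (`C_p = l_pp`), `edgeWeight_eq_diagonal_sub_wLaplacian`
  (`A = D − L`), **Cor 3.3** `pinv_mul_wLaplacian_apply` / `wLaplacian_mul_pinv_apply`, **Lemma 3.4**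
  `Cinkir2009_lemma_3_4` (all `p, q`, from the tree's Klein–Randić theorem `effectiveResistance_eq_pinv_entries`),
  **Lemma 3.5** `Cinkir2009_lemma_3_5` and **(1.1b)** `Cinkir2009_eq_1_1b`, `voltage_symm` (`j_z(x,y) = j_z(y,x)`,
  reciprocity).
* §2 (Cinkir §4 preamble): `sum_networkKernel_pow` (`Σ_t p⁽ᵏ⁾_it = 1`), `sum_nodeConductance_mul_networkKernel_pow`
  (`Σ_i C_i p⁽ᵏ⁾_it = C_t`), `trace_networkKernel_edgeWeight` (`tr P = 0`: no loops), `trace_networkKernel_sq`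
  (`tr P² = Σ_{p,q} C_pq²/(C_p C_q)`).
* §3 **Proposition 4.1** `Cinkir2009_prop_4_1` (every `k ≥ 0`) and the closed form `Cinkir2009_eq_4_3`
  (`Σ_{i,t} C_i l⁺_it p⁽ᵏ⁾_it = Σ_i C_i l⁺_ii + k − Σ_{j<k} tr(Pʲ)`, every `k ≥ 0`) / `Cinkir2009_eq_4_3'` (as printed,
  `k ≥ 1`).
* §4 **Theorem 4.2** `Cinkir2009_thm_4_2` and **Corollary 4.3 = the extended Foster identities (BCEG 2008)**
  `extendedFosterIdentity` (`k ≥ 1`, as printed) with the all-`k` form `extendedFosterIdentity_range`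
  (`½ Σ_{i,t} C_i r(i,t) p⁽ᵏ⁾_it = Σ_{j<k} tr(Pʲ) − k`).
* §5 the named cases: **Foster's first identity** `fosterFirstIdentity` (`½ Σ_{p,q} C_pq r(p,q) = n − 1` — the
  tree's `FosterTheorem.LyonsPeres2016_ex_4_29` by hitting times; here by the trace method), **FOSTER'S SECOND
  IDENTITY (Foster 1961)** `fosterSecondIdentity` (`½ Σ_{p} Σ_{w,q} r(w,q) C_wp C_pq / C_p = n − 2`) and Palacios's
  **third identity** `fosterThirdIdentity` (`½ Σ_{i,t} C_i r(i,t) p⁽³⁾_it = n − 3 + Σ_{p,q} C_pq²/(C_pC_q)`); and for a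
  connected simple graph with unit resistances (Markowsky–Palacios §2) **Theorem 1** `MarkowskyPalacios2016_thm_1`
  (`Σ_i Σ_j deg(i) (Pʳ)_ij R_ij = 2(Σ_{s<r} tr(Pˢ) − r)`, `P = srwKernel G`), (foster1) `MarkowskyPalacios2016_foster1`
  (`Σ_v Σ_{y∼v} R_vy = 2(n−1)`) and (foster2) `MarkowskyPalacios2016_foster2` (`Σ_v Σ_y Σ_x [x∼y][y∼v] R_xv/deg(y) =
  2(n−2)`, the weight `1/deg` at the MIDDLE vertex `y = v_1` of the path `x ∼ y ∼ v`, as in Theorem 1 with `r = 2`).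

NOT CLAIMED: metrized graphs with non-optimal vertex sets (loops / multiple edges), the equilibrium-measure proof
(Prop. 4.4, [BCEG]), infinite graphs (Markowsky–Palacios §§3–6), the walk-indexed form of Theorem 1's left side
(we keep the matrix entry `deg(i)(Pʳ)_ij = Σ_{walks i ∼ v_1 ∼ ⋯ ∼ v_{r−1} ∼ j} 1/(deg v_1 ⋯ deg v_{r−1})` unexpanded
except for `r = 1, 2`).  THEOREMS ONLY (no definition, no named fact, net debt 0).
-/

noncomputable section

open Finset Matrix SimpleGraph
open Literature.LinearAlgebra.Matrix Literature.LinearAlgebra.Matrix.MoorePenrose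
open Literature.Combinatorics.SimpleGraph.WeightedMatrixForest
open Literature.Probability.NegativeDependence

namespace Literature.Probability.MarkovChains

section Network

variable {V : Type*} [Fintype V] [DecidableEq V] {G : SimpleGraph V} [DecidableRel G.Adj] (c : Sym2 V → ℝ)

/-! ## §1 `C_p = l_pp`, `A = D − L`, Corollary 3.3, Lemma 3.4, Lemma 3.5, (1.1b) -/

omit [Fintype V] [DecidableEq V] [DecidableRel G.Adj] in
/-- A connected graph on at least two vertices has an edge. [cite: Cinkir2009, §2 («A metrized graph `Γ` is a
finite connected graph»)] -/
private theorem exists_edge [Nontrivial V] (hG : G.Connected) : ∃ e : Sym2 V, e ∈ G.edgeSet := by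
  obtain ⟨a, z, haz⟩ := exists_pair_ne V
  obtain ⟨p⟩ := hG.preconnected a z
  cases p with
  | nil => exact absurd rfl haz
  | cons h _ => exact ⟨_, G.mem_edgeSet.2 h⟩

omit [DecidableEq V] in
/-- The network `(G, c)` is a conductance structure (`n ≥ 2`, `G` connected, `c > 0`). [cite: Cinkir2009, §4
(«`C_pq = C_qp = 1/L_i` as the conductance of the edge»)] -/
private theorem isConductance [Nontrivial V] (hG : G.Connected) (hc : ∀ e, 0 < c e) :
    IsConductance (edgeWeight G c) := by
  obtain ⟨e, he⟩ := exists_edge hG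
  exact isConductance_edgeWeight c hG hc ⟨e, he⟩

/-- **`C_p = l_pp`**: the node conductance is the diagonal entry of the discrete Laplacian (no self-loops).
[cite: Cinkir2009, §4 («It follows from the definitions that `C_p = l_pp`»)] -/
theorem nodeConductance_edgeWeight_eq (p : V) :
    nodeConductance (edgeWeight G c) p = wLaplacian (edgeWeight G c) p p := by
  rw [nodeConductance_def, wLaplacian_apply_self, ← Finset.add_sum_erase _ _ (mem_univ p), edgeWeight_self,
    zero_add]

/-- **`A = D − L`**: `C_pq = [p = q] C_p − l_pq` («`C_p = l_pp` and `C_pq = −l_pq` if `p ≠ q`», `C_pp = 0`).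
[cite: Cinkir2009, §4 (display before Prop. 4.1) and §3 («`L := D − A`»)] -/
theorem edgeWeight_eq_diagonal_sub_wLaplacian (p q : V) :
    edgeWeight G c p q =
      (if p = q then nodeConductance (edgeWeight G c) p else 0) - wLaplacian (edgeWeight G c) p q := by
  by_cases h : p = q
  · subst h
    rw [if_pos rfl, nodeConductance_edgeWeight_eq, sub_self, edgeWeight_self]
  · rw [if_neg h, wLaplacian_apply_of_ne _ h, zero_sub, neg_neg]

/-- **Corollary 3.3**: `Σ_s l⁺_ps l_sq = (n−1)/n` if `p = q` and `−1/n` otherwise, i.e. the entries of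
`L⁺L = I − J/n`. [cite: Cinkir2009, Cor. 3.3 with Lemma 3.2] -/
theorem pinv_mul_wLaplacian_apply [Nontrivial V] (hG : G.Connected) (hc : ∀ e, 0 < c e) (p q : V) :
    (pinv (wLaplacian (edgeWeight G c)) * wLaplacian (edgeWeight G c)) p q =
      (if p = q then 1 else 0) - 1 / (Fintype.card V : ℝ) := by
  rw [pinv_mul_wLaplacian c hG hc, Matrix.sub_apply, Matrix.smul_apply, one_apply, of_apply, smul_eq_mul,
    mul_one]

/-- **Lemma 3.2, entrywise**: `Σ_s l_ps l⁺_sq = [p = q] − 1/n` (`LL⁺ = I − J/n`). [cite: Cinkir2009, Lemma 3.2] -/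
theorem wLaplacian_mul_pinv_apply [Nontrivial V] (hG : G.Connected) (hc : ∀ e, 0 < c e) (p q : V) :
    (wLaplacian (edgeWeight G c) * pinv (wLaplacian (edgeWeight G c))) p q =
      (if p = q then 1 else 0) - 1 / (Fintype.card V : ℝ) := by
  rw [wLaplacian_mul_pinv c hG hc, Matrix.sub_apply, Matrix.smul_apply, one_apply, of_apply, smul_eq_mul,
    mul_one]

/-- **Lemma 3.4 (Bapat; Klein–Randić)**: `r(p,q) = l⁺_pp − 2 l⁺_pq + l⁺_qq` for ANY `p, q` (for `p = q` both
sides vanish). The case `p ≠ q` is the tree's `effectiveResistance_eq_pinv_entries`. [cite: Cinkir2009, Lemma 3.4] -/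
theorem Cinkir2009_lemma_3_4 (hG : G.Connected) (hc : ∀ e, 0 < c e) (p q : V) :
    effectiveResistance (edgeWeight G c) p q =
      pinv (wLaplacian (edgeWeight G c)) p p - 2 * pinv (wLaplacian (edgeWeight G c)) p q +
        pinv (wLaplacian (edgeWeight G c)) q q := by
  rcases eq_or_ne p q with rfl | hpq
  · rw [effectiveResistance_self]
    ring
  · rw [effectiveResistance_eq_pinv_entries c hG hc hpq]
    ring

/-- `(𝟙_x − 𝟙_z)·L⁺(𝟙_y − 𝟙_z) = l⁺_xy − l⁺_xz − l⁺_zy + l⁺_zz`. [cite: Cinkir2009, Lemma 3.5 (proof)] -/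
private theorem single_sub_dotProduct_pinv_mulVec (x y z : V) :
    ((Pi.single x 1 : V → ℝ) - Pi.single z 1) ⬝ᵥ
        (pinv (wLaplacian (edgeWeight G c)) *ᵥ ((Pi.single y 1 : V → ℝ) - Pi.single z 1)) =
      pinv (wLaplacian (edgeWeight G c)) x y - pinv (wLaplacian (edgeWeight G c)) x z -
        pinv (wLaplacian (edgeWeight G c)) z y + pinv (wLaplacian (edgeWeight G c)) z z := by
  rw [mulVec_sub, mulVec_single_one, mulVec_single_one, sub_dotProduct, dotProduct_sub, dotProduct_sub,
    single_dotProduct, single_dotProduct, single_dotProduct, single_dotProduct, col_apply, col_apply, col_apply,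
    col_apply]
  ring

/-- **Lemma 3.5 in the tree's vocabulary**: Cinkir's voltage function `j_p(q,s)` — the voltage at `q`, grounded at
`p`, when unit current enters at `s` and exits at `p` — is `𝓡(s ↔ p) · W(q)` for the tree's unit voltage `W` from
`s` to `p` (`W(s) = 1`, `W(p) = 0`), and **`j_p(q,s) = l⁺_pp − l⁺_pq − l⁺_ps + l⁺_qs`** (for `s = p` both sides are
`0`). [cite: Cinkir2009, Lemma 3.5; §2 (definition of `j_z(x,y)`)] -/
theorem Cinkir2009_lemma_3_5 (hG : G.Connected) (hc : ∀ e, 0 < c e) (p q s : V) :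
    effectiveResistance (edgeWeight G c) s p * unitVoltage (edgeWeight G c) s p q =
      pinv (wLaplacian (edgeWeight G c)) p p - pinv (wLaplacian (edgeWeight G c)) p q -
        pinv (wLaplacian (edgeWeight G c)) p s + pinv (wLaplacian (edgeWeight G c)) q s := by
  rcases eq_or_ne s p with rfl | hsp
  · rw [effectiveResistance_self, zero_mul, pinv_wLaplacian_apply_comm c (fun e => (hc e).le) q s]
    ring
  · haveI : Nontrivial V := ⟨⟨s, p, hsp⟩⟩
    have hcond := isConductance c hG hc
    obtain ⟨e, he⟩ := exists_edge (G := G) hG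
    have hirr := isIrreducible_networkKernel_edgeWeight c hG hc ⟨e, he⟩
    have hR := (effectiveResistance_pos hcond hirr hsp).ne'
    rw [unitVoltage_eq_pinv c hG hc hsp q, ← effectiveResistance_eq_dotProduct_pinv c hG hc hsp,
      mul_div_cancel₀ _ hR, single_sub_dotProduct_pinv_mulVec,
      pinv_wLaplacian_apply_comm c (fun e => (hc e).le) q p]
    ring

/-- **`j_z(x,y) = j_z(y,x)`** («the voltage function `j_x(y,z)` on `Γ` is a symmetric function in `y` and `z`» —
the reciprocity theorem): `𝓡(y ↔ z) W^{y→z}(x) = 𝓡(x ↔ z) W^{x→z}(y)`. [cite: Cinkir2009, §2] -/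
theorem voltage_symm (hG : G.Connected) (hc : ∀ e, 0 < c e) (x y z : V) :
    effectiveResistance (edgeWeight G c) y z * unitVoltage (edgeWeight G c) y z x =
      effectiveResistance (edgeWeight G c) x z * unitVoltage (edgeWeight G c) x z y := by
  rw [Cinkir2009_lemma_3_5 c hG hc, Cinkir2009_lemma_3_5 c hG hc,
    pinv_wLaplacian_apply_comm c (fun e => (hc e).le) x y]
  ring

/-- **(1.1b)** «`2 j_p(x,q) = r(p,x) + r(p,q) − r(q,x)`, for any `p, q, x`». [cite: Cinkir2009, §2 eq. (1.1b)] -/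
theorem Cinkir2009_eq_1_1b (hG : G.Connected) (hc : ∀ e, 0 < c e) (p q x : V) :
    2 * (effectiveResistance (edgeWeight G c) q p * unitVoltage (edgeWeight G c) q p x) =
      effectiveResistance (edgeWeight G c) p x + effectiveResistance (edgeWeight G c) p q -
        effectiveResistance (edgeWeight G c) q x := by
  rw [Cinkir2009_lemma_3_5 c hG hc, Cinkir2009_lemma_3_4 c hG hc, Cinkir2009_lemma_3_4 c hG hc,
    Cinkir2009_lemma_3_4 c hG hc, pinv_wLaplacian_apply_comm c (fun e => (hc e).le) x q]
  ring

/-! ## §2 The network walk `P`: `Σ_t p⁽ᵏ⁾_it = 1`, `Σ_i C_i p⁽ᵏ⁾_it = C_t`, `tr P = 0`, `tr P²` -/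

/-- «`Σ_{t} p⁽ᵏ⁾_it = 1`» — every power of the transition matrix is stochastic. [cite: Cinkir2009, §4 (display
before Prop. 4.1)] -/
theorem sum_networkKernel_pow [Nontrivial V] (hG : G.Connected) (hc : ∀ e, 0 < c e) (k : ℕ) (i : V) :
    ∑ t, (networkKernel (edgeWeight G c) ^ k) i t = 1 := by
  induction k generalizing i with
  | zero =>
      simp_rw [pow_zero, one_apply]
      rw [Finset.sum_ite_eq]
      simp
  | succ k ih =>
      simp_rw [pow_succ, Matrix.mul_apply]
      rw [Finset.sum_comm]
      simp_rw [← Finset.mul_sum, sum_networkKernel (isConductance c hG hc), mul_one]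
      exact ih i

/-- «`Σ_{i} C_i p⁽ᵏ⁾_it = C_t` for any `k`» — the conductances are stationary for every power of `P`
(reversibility `C_i p_it = C_it = C_ti`). [cite: Cinkir2009, §4 (display before Prop. 4.1)] -/
theorem sum_nodeConductance_mul_networkKernel_pow [Nontrivial V] (hG : G.Connected) (hc : ∀ e, 0 < c e)
    (k : ℕ) (t : V) :
    ∑ i, nodeConductance (edgeWeight G c) i * (networkKernel (edgeWeight G c) ^ k) i t =
      nodeConductance (edgeWeight G c) t := by
  have hcond := isConductance c hG hc
  induction k generalizing t with
  | zero =>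
      simp_rw [pow_zero, one_apply, mul_ite, mul_one, mul_zero]
      rw [Finset.sum_ite_eq']
      simp
  | succ k ih =>
      simp_rw [pow_succ, Matrix.mul_apply, Finset.mul_sum]
      rw [Finset.sum_comm]
      simp_rw [← mul_assoc, ← Finset.sum_mul, ih, nodeConductance_mul_networkKernel hcond]
      rw [nodeConductance_def]
      exact sum_congr rfl fun i _ => edgeWeight_comm c i t

/-- `tr(P⁰) = n`. [cite: MarkowskyPalacios2016, §2 («Note that `tr(P⁰) = n`»)] -/
theorem trace_networkKernel_pow_zero :
    (networkKernel (edgeWeight G c) ^ 0).trace = (Fintype.card V : ℝ) := by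
  rw [pow_zero, trace_one]

omit [DecidableEq V] in
/-- **`tr(P) = 0`**: an optimal vertex set has no self-loops. [cite: Cinkir2009, §3 («no self-loops»);
MarkowskyPalacios2016, §2 («`tr(P¹) = 0`»)] -/
theorem trace_networkKernel_edgeWeight : (networkKernel (edgeWeight G c)).trace = 0 := by
  rw [Matrix.trace]
  exact sum_eq_zero fun i _ => by rw [diag_apply, networkKernel_apply, edgeWeight_self, zero_div]

/-- **`tr(P²) = Σ_{p,q} C_pq²/(C_p C_q)`** (the `k = 3` correction term). [cite: Cinkir2009, §4 (third displayed
identity of [C1]: `½ Σ_{p ∼ q} C_pq²/(C_pC_q)`)] -/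
theorem trace_networkKernel_sq :
    (networkKernel (edgeWeight G c) ^ 2).trace =
      ∑ p, ∑ q, edgeWeight G c p q ^ 2 / (nodeConductance (edgeWeight G c) p * nodeConductance (edgeWeight G c) q) := by
  rw [Matrix.trace, sq]
  refine sum_congr rfl fun p _ => ?_
  rw [diag_apply, Matrix.mul_apply]
  refine sum_congr rfl fun q _ => ?_
  rw [networkKernel_apply, networkKernel_apply, edgeWeight_comm c q p]
  ring

/-! ## §3 Proposition 4.1 and its closed form -/

/-- The discrete Laplacian is symmetric. [cite: Cinkir2009, §3 Remark 3.1] -/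
private theorem wLaplacian_edgeWeight_comm (t m : V) :
    wLaplacian (edgeWeight G c) t m = wLaplacian (edgeWeight G c) m t := by
  by_cases h : t = m
  · rw [h]
  · rw [wLaplacian_apply_of_ne _ h, wLaplacian_apply_of_ne _ (Ne.symm h), edgeWeight_comm c t m]

/-- `Σ_t l⁺_it C_mt = C_m l⁺_im − [i = m] + 1/n` (the display (4.1) in the proof of Prop. 4.1: `Σ_i l⁺_it C_iq =
C_q l⁺_qt − {−1/n, (n−1)/n}`). [cite: Cinkir2009, Prop. 4.1 (proof, first display)] -/
theorem sum_pinv_mul_edgeWeight [Nontrivial V] (hG : G.Connected) (hc : ∀ e, 0 < c e) (i m : V) :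
    ∑ t, pinv (wLaplacian (edgeWeight G c)) i t * edgeWeight G c m t =
      nodeConductance (edgeWeight G c) m * pinv (wLaplacian (edgeWeight G c)) i m - (if i = m then 1 else 0) +
        1 / (Fintype.card V : ℝ) := by
  have hL : ∀ t, edgeWeight G c m t =
      (if m = t then nodeConductance (edgeWeight G c) m else 0) - wLaplacian (edgeWeight G c) t m := fun t => by
    rw [edgeWeight_eq_diagonal_sub_wLaplacian c m t, wLaplacian_edgeWeight_comm c m t]
  simp_rw [hL, mul_sub, mul_ite, mul_zero, Finset.sum_sub_distrib]
  rw [Finset.sum_ite_eq]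
  simp only [mem_univ, if_true]
  have h2 : ∑ t, pinv (wLaplacian (edgeWeight G c)) i t * wLaplacian (edgeWeight G c) t m =
      (if i = m then 1 else 0) - 1 / (Fintype.card V : ℝ) := by
    rw [← pinv_mul_wLaplacian_apply c hG hc i m, Matrix.mul_apply]
  rw [h2]
  ring

/-- **Proposition 4.1**: `Σ_{i,t} C_i l⁺_it p⁽ᵏ⁺¹⁾_it = 1 − tr(Pᵏ) + Σ_{i,t} C_i l⁺_it p⁽ᵏ⁾_it` (printed for
`k ≥ 1`; the computation is valid for every `k ≥ 0`). [cite: Cinkir2009, Prop. 4.1] -/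
theorem Cinkir2009_prop_4_1 [Nontrivial V] (hG : G.Connected) (hc : ∀ e, 0 < c e) (k : ℕ) :
    ∑ i, ∑ t, nodeConductance (edgeWeight G c) i * pinv (wLaplacian (edgeWeight G c)) i t *
        (networkKernel (edgeWeight G c) ^ (k + 1)) i t =
      1 - (networkKernel (edgeWeight G c) ^ k).trace +
        ∑ i, ∑ t, nodeConductance (edgeWeight G c) i * pinv (wLaplacian (edgeWeight G c)) i t *
          (networkKernel (edgeWeight G c) ^ k) i t := by
  have hcond := isConductance c hG hc
  have hn : (Fintype.card V : ℝ) ≠ 0 := Nat.cast_ne_zero.2 Fintype.card_ne_zero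
  -- expand `p⁽ᵏ⁺¹⁾_it = Σ_m p⁽ᵏ⁾_im C_mt / C_m` and sum over `t` first
  have step1 : ∀ i, ∑ t, nodeConductance (edgeWeight G c) i * pinv (wLaplacian (edgeWeight G c)) i t *
        (networkKernel (edgeWeight G c) ^ (k + 1)) i t =
      ∑ m, nodeConductance (edgeWeight G c) i * (networkKernel (edgeWeight G c) ^ k) i m /
          nodeConductance (edgeWeight G c) m *
        ∑ t, pinv (wLaplacian (edgeWeight G c)) i t * edgeWeight G c m t := fun i => by
    have h1 : ∀ t, nodeConductance (edgeWeight G c) i * pinv (wLaplacian (edgeWeight G c)) i t *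
          (networkKernel (edgeWeight G c) ^ (k + 1)) i t =
        ∑ m, nodeConductance (edgeWeight G c) i * (networkKernel (edgeWeight G c) ^ k) i m /
            nodeConductance (edgeWeight G c) m *
          (pinv (wLaplacian (edgeWeight G c)) i t * edgeWeight G c m t) := fun t => by
      rw [pow_succ, Matrix.mul_apply, Finset.mul_sum]
      refine sum_congr rfl fun m _ => ?_
      rw [networkKernel_apply]
      ring
    simp_rw [h1]
    rw [Finset.sum_comm]
    exact sum_congr rfl fun m _ => by rw [Finset.mul_sum]
  simp_rw [step1, sum_pinv_mul_edgeWeight c hG hc]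
  -- split the three terms
  have step2 : ∀ i m, nodeConductance (edgeWeight G c) i * (networkKernel (edgeWeight G c) ^ k) i m /
        nodeConductance (edgeWeight G c) m *
      (nodeConductance (edgeWeight G c) m * pinv (wLaplacian (edgeWeight G c)) i m - (if i = m then 1 else 0) +
        1 / (Fintype.card V : ℝ)) =
      nodeConductance (edgeWeight G c) i * pinv (wLaplacian (edgeWeight G c)) i m *
          (networkKernel (edgeWeight G c) ^ k) i m -
        (if i = m then (networkKernel (edgeWeight G c) ^ k) i i else 0) +
        1 / (Fintype.card V : ℝ) * (nodeConductance (edgeWeight G c) i * (networkKernel (edgeWeight G c) ^ k) i m /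
          nodeConductance (edgeWeight G c) m) := fun i m => by
    have hm := hcond.nodeConductance_ne_zero m
    by_cases him : i = m
    · subst him
      rw [if_pos rfl, if_pos rfl]
      field_simp
    · rw [if_neg him, if_neg him]
      field_simp
      ring
  simp_rw [step2, Finset.sum_add_distrib, Finset.sum_sub_distrib, Finset.sum_ite_eq, if_pos (mem_univ _),
    ← Finset.mul_sum]
  have step3 : ∑ i, ∑ m, nodeConductance (edgeWeight G c) i * (networkKernel (edgeWeight G c) ^ k) i m /
      nodeConductance (edgeWeight G c) m = (Fintype.card V : ℝ) := by
    rw [Finset.sum_comm]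
    simp_rw [div_eq_mul_inv, ← Finset.sum_mul, sum_nodeConductance_mul_networkKernel_pow c hG hc k,
      mul_inv_cancel₀ (hcond.nodeConductance_ne_zero _)]
    simp
  rw [step3, Matrix.trace]
  simp only [diag_apply]
  field_simp
  ring

/-- **The closed form of Prop. 4.1, every `k ≥ 0`**: `Σ_{i,t} C_i l⁺_it p⁽ᵏ⁾_it = Σ_i C_i l⁺_ii + k − Σ_{j<k}
tr(Pʲ)`. [cite: Cinkir2009, §4 eq. (4.3) (display after Prop. 4.1)] -/
theorem Cinkir2009_eq_4_3 [Nontrivial V] (hG : G.Connected) (hc : ∀ e, 0 < c e) (k : ℕ) :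
    ∑ i, ∑ t, nodeConductance (edgeWeight G c) i * pinv (wLaplacian (edgeWeight G c)) i t *
        (networkKernel (edgeWeight G c) ^ k) i t =
      ∑ i, nodeConductance (edgeWeight G c) i * pinv (wLaplacian (edgeWeight G c)) i i + k -
        ∑ j ∈ Finset.range k, (networkKernel (edgeWeight G c) ^ j).trace := by
  induction k with
  | zero =>
      simp_rw [pow_zero, one_apply, mul_ite, mul_one, mul_zero]
      simp [Finset.sum_ite_eq]
  | succ k ih =>
      rw [Cinkir2009_prop_4_1 c hG hc k, ih, Finset.sum_range_succ, Nat.cast_succ]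
      ring

/-- **Eq. (4.3) as printed (`k ≥ 1`)**: «`Σ_{i,t} C_i l⁺_it p⁽ᵏ⁾_it = k − n − Σ_{i=1}^{k−1} tr(Pⁱ) + Σ_i C_i
l⁺_ii`». [cite: Cinkir2009, §4 eq. (4.3)] -/
theorem Cinkir2009_eq_4_3' [Nontrivial V] (hG : G.Connected) (hc : ∀ e, 0 < c e) {k : ℕ} (hk : 1 ≤ k) :
    ∑ i, ∑ t, nodeConductance (edgeWeight G c) i * pinv (wLaplacian (edgeWeight G c)) i t *
        (networkKernel (edgeWeight G c) ^ k) i t =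
      k - (Fintype.card V : ℝ) - ∑ j ∈ Finset.Ico 1 k, (networkKernel (edgeWeight G c) ^ j).trace +
        ∑ i, nodeConductance (edgeWeight G c) i * pinv (wLaplacian (edgeWeight G c)) i i := by
  rw [Cinkir2009_eq_4_3 c hG hc k, Finset.range_eq_Ico, ← Finset.sum_Ico_consecutive _ (Nat.zero_le 1) hk,
    Finset.sum_Ico_succ_top (Nat.le_refl 0), Finset.Ico_self, Finset.sum_empty, zero_add,
    trace_networkKernel_pow_zero]
  ring

/-! ## §4 Theorem 4.2 (voltage form) and Corollary 4.3 (the extended Foster identities) -/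

/-- **Theorem 4.2, every `k ≥ 0`**: `Σ_{i,t} C_i j_i(s,t) p⁽ᵏ⁾_it = Σ_{j<k} tr(Pʲ) − k` with `j_i(s,t) =
𝓡(t ↔ i) W^{t→i}(s)`. [cite: Cinkir2009, Thm. 4.2 (proof)] -/
theorem Cinkir2009_thm_4_2_range [Nontrivial V] (hG : G.Connected) (hc : ∀ e, 0 < c e) (s : V) (k : ℕ) :
    ∑ i, ∑ t, nodeConductance (edgeWeight G c) i *
        (effectiveResistance (edgeWeight G c) t i * unitVoltage (edgeWeight G c) t i s) *
        (networkKernel (edgeWeight G c) ^ k) i t =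
      ∑ j ∈ Finset.range k, (networkKernel (edgeWeight G c) ^ j).trace - k := by
  have hj : ∀ i t, effectiveResistance (edgeWeight G c) t i * unitVoltage (edgeWeight G c) t i s =
      pinv (wLaplacian (edgeWeight G c)) i i - pinv (wLaplacian (edgeWeight G c)) i s -
        pinv (wLaplacian (edgeWeight G c)) i t + pinv (wLaplacian (edgeWeight G c)) s t :=
    fun i t => Cinkir2009_lemma_3_5 c hG hc i s t
  simp_rw [hj]
  have hsplit : ∀ i, ∑ t, nodeConductance (edgeWeight G c) i *
        (pinv (wLaplacian (edgeWeight G c)) i i - pinv (wLaplacian (edgeWeight G c)) i s -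
          pinv (wLaplacian (edgeWeight G c)) i t + pinv (wLaplacian (edgeWeight G c)) s t) *
        (networkKernel (edgeWeight G c) ^ k) i t =
      nodeConductance (edgeWeight G c) i *
          (pinv (wLaplacian (edgeWeight G c)) i i - pinv (wLaplacian (edgeWeight G c)) i s) *
          ∑ t, (networkKernel (edgeWeight G c) ^ k) i t -
        ∑ t, nodeConductance (edgeWeight G c) i * pinv (wLaplacian (edgeWeight G c)) i t *
          (networkKernel (edgeWeight G c) ^ k) i t +
        ∑ t, pinv (wLaplacian (edgeWeight G c)) s t *
          (nodeConductance (edgeWeight G c) i * (networkKernel (edgeWeight G c) ^ k) i t) := by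
    intro i
    rw [Finset.mul_sum, ← Finset.sum_sub_distrib, ← Finset.sum_add_distrib]
    exact sum_congr rfl fun t _ => by ring
  simp_rw [hsplit, sum_networkKernel_pow c hG hc k, mul_one, Finset.sum_add_distrib, Finset.sum_sub_distrib]
  rw [Cinkir2009_eq_4_3 c hG hc k]
  rw [Finset.sum_comm (f := fun i t => pinv (wLaplacian (edgeWeight G c)) s t *
    (nodeConductance (edgeWeight G c) i * (networkKernel (edgeWeight G c) ^ k) i t))]
  simp_rw [← Finset.mul_sum, sum_nodeConductance_mul_networkKernel_pow c hG hc k, mul_sub,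
    Finset.sum_sub_distrib]
  have hsym : ∑ t, pinv (wLaplacian (edgeWeight G c)) s t * nodeConductance (edgeWeight G c) t =
      ∑ i, nodeConductance (edgeWeight G c) i * pinv (wLaplacian (edgeWeight G c)) i s :=
    sum_congr rfl fun t _ => by rw [pinv_wLaplacian_apply_comm c (fun e => (hc e).le) s t, mul_comm]
  rw [hsym]
  ring

/-- **Theorem 4.2 (Cinkir's main result), as printed**: «Let `s ∈ V(Γ)`. For any `k ≥ 1`, we have
`Σ_{i,t} C_i j_i(s,t) p⁽ᵏ⁾_it = n − k + Σ_{i=1}^{k−1} tr(Pⁱ)`», with the voltage function `j_i(s,t) = 𝓡(t ↔ i) ·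
W^{t→i}(s)` (unit current in at `t`, out at `i`, grounded at `i`, read at `s`). [cite: Cinkir2009, Thm. 4.2] -/
theorem Cinkir2009_thm_4_2 [Nontrivial V] (hG : G.Connected) (hc : ∀ e, 0 < c e) (s : V) {k : ℕ} (hk : 1 ≤ k) :
    ∑ i, ∑ t, nodeConductance (edgeWeight G c) i *
        (effectiveResistance (edgeWeight G c) t i * unitVoltage (edgeWeight G c) t i s) *
        (networkKernel (edgeWeight G c) ^ k) i t =
      (Fintype.card V : ℝ) - k + ∑ j ∈ Finset.Ico 1 k, (networkKernel (edgeWeight G c) ^ j).trace := by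
  rw [Cinkir2009_thm_4_2_range c hG hc s k, Finset.range_eq_Ico,
    ← Finset.sum_Ico_consecutive _ (Nat.zero_le 1) hk, Finset.sum_Ico_succ_top (Nat.le_refl 0), Finset.Ico_self,
    Finset.sum_empty, zero_add, trace_networkKernel_pow_zero]
  ring

/-- **The extended Foster identities, every `k ≥ 0`**: `½ Σ_{i,t} C_i r(i,t) p⁽ᵏ⁾_it = Σ_{j<k} tr(Pʲ) − k`.
[cite: Cinkir2009, Cor. 4.3; MarkowskyPalacios2016, §2 Thm. 1] -/
theorem extendedFosterIdentity_range [Nontrivial V] (hG : G.Connected) (hc : ∀ e, 0 < c e) (k : ℕ) :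
    (1 / 2 : ℝ) * ∑ i, ∑ t, nodeConductance (edgeWeight G c) i * effectiveResistance (edgeWeight G c) i t *
        (networkKernel (edgeWeight G c) ^ k) i t =
      ∑ j ∈ Finset.range k, (networkKernel (edgeWeight G c) ^ j).trace - k := by
  have hr : ∀ i t, effectiveResistance (edgeWeight G c) i t =
      pinv (wLaplacian (edgeWeight G c)) i i - 2 * pinv (wLaplacian (edgeWeight G c)) i t +
        pinv (wLaplacian (edgeWeight G c)) t t :=
    fun i t => Cinkir2009_lemma_3_4 c hG hc i t
  simp_rw [hr]
  have hsplit : ∀ i, ∑ t, nodeConductance (edgeWeight G c) i *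
        (pinv (wLaplacian (edgeWeight G c)) i i - 2 * pinv (wLaplacian (edgeWeight G c)) i t +
          pinv (wLaplacian (edgeWeight G c)) t t) * (networkKernel (edgeWeight G c) ^ k) i t =
      nodeConductance (edgeWeight G c) i * pinv (wLaplacian (edgeWeight G c)) i i *
          ∑ t, (networkKernel (edgeWeight G c) ^ k) i t -
        2 * ∑ t, nodeConductance (edgeWeight G c) i * pinv (wLaplacian (edgeWeight G c)) i t *
          (networkKernel (edgeWeight G c) ^ k) i t +
        ∑ t, pinv (wLaplacian (edgeWeight G c)) t t *
          (nodeConductance (edgeWeight G c) i * (networkKernel (edgeWeight G c) ^ k) i t) := by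
    intro i
    rw [Finset.mul_sum, Finset.mul_sum, ← Finset.sum_sub_distrib, ← Finset.sum_add_distrib]
    exact sum_congr rfl fun t _ => by ring
  simp_rw [hsplit, sum_networkKernel_pow c hG hc k, mul_one, Finset.sum_add_distrib, Finset.sum_sub_distrib,
    ← Finset.mul_sum]
  rw [Cinkir2009_eq_4_3 c hG hc k]
  rw [Finset.sum_comm (f := fun i t => pinv (wLaplacian (edgeWeight G c)) t t *
    (nodeConductance (edgeWeight G c) i * (networkKernel (edgeWeight G c) ^ k) i t))]
  simp_rw [← Finset.mul_sum, sum_nodeConductance_mul_networkKernel_pow c hG hc k]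
  have hsym : ∑ t, pinv (wLaplacian (edgeWeight G c)) t t * nodeConductance (edgeWeight G c) t =
      ∑ i, nodeConductance (edgeWeight G c) i * pinv (wLaplacian (edgeWeight G c)) i i :=
    sum_congr rfl fun t _ => mul_comm _ _
  rw [hsym]
  ring

/-- **Corollary 4.3 — THE EXTENDED FOSTER IDENTITIES (Bendito–Carmona–Encinas–Gesto 2008), as printed**: «For
any `k ≥ 1`, we have `½ Σ_{i,t} C_i r(i,t) p⁽ᵏ⁾_it = n − k + Σ_{i=1}^{k−1} tr(Pⁱ)`.» [cite: Cinkir2009, Cor. 4.3] -/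
theorem extendedFosterIdentity [Nontrivial V] (hG : G.Connected) (hc : ∀ e, 0 < c e) {k : ℕ} (hk : 1 ≤ k) :
    (1 / 2 : ℝ) * ∑ i, ∑ t, nodeConductance (edgeWeight G c) i * effectiveResistance (edgeWeight G c) i t *
        (networkKernel (edgeWeight G c) ^ k) i t =
      (Fintype.card V : ℝ) - k + ∑ j ∈ Finset.Ico 1 k, (networkKernel (edgeWeight G c) ^ j).trace := by
  rw [extendedFosterIdentity_range c hG hc k, Finset.range_eq_Ico,
    ← Finset.sum_Ico_consecutive _ (Nat.zero_le 1) hk, Finset.sum_Ico_succ_top (Nat.le_refl 0), Finset.Ico_self,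
    Finset.sum_empty, zero_add, trace_networkKernel_pow_zero]
  ring

/-! ## §5 Foster's first, second and third identities -/

/-- **Foster's first identity (Foster 1949) by the trace method**: `½ Σ_{p,q} C_pq r(p,q) = n − 1` — the sum of
`C_e r(e)` over the edges. (The tree's `LyonsPeres2016_ex_4_29` is the same identity for conductance matrices, proved
through hitting times.) [cite: Cinkir2009, §1 («Foster's first identity»), Cor. 4.3 (`k = 1`); MarkowskyPalacios2016,
§2 eq. (foster1)] -/
theorem fosterFirstIdentity [Nontrivial V] (hG : G.Connected) (hc : ∀ e, 0 < c e) :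
    (1 / 2 : ℝ) * ∑ p, ∑ q, edgeWeight G c p q * effectiveResistance (edgeWeight G c) p q =
      (Fintype.card V : ℝ) - 1 := by
  have h := extendedFosterIdentity c hG hc (le_refl 1)
  rw [Finset.Ico_self, Finset.sum_empty, add_zero, Nat.cast_one, pow_one] at h
  rw [← h]
  congr 1
  refine sum_congr rfl fun p _ => sum_congr rfl fun q _ => ?_
  rw [mul_right_comm, nodeConductance_mul_networkKernel (isConductance c hG hc)]

/-- `C_i p⁽²⁾_it = Σ_p C_ip C_pt / C_p` (two-step weights). [cite: Cinkir2009, §4 («`p⁽ᵏ⁺¹⁾_it = Σ C_{im₁} C_{m₁m₂}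
⋯ C_{m_k t}/(C_i C_{m₁} ⋯ C_{m_k})`»)] -/
theorem nodeConductance_mul_networkKernel_sq [Nontrivial V] (hG : G.Connected) (hc : ∀ e, 0 < c e) (i t : V) :
    nodeConductance (edgeWeight G c) i * (networkKernel (edgeWeight G c) ^ 2) i t =
      ∑ p, edgeWeight G c i p * edgeWeight G c p t / nodeConductance (edgeWeight G c) p := by
  have hcond := isConductance c hG hc
  rw [sq, Matrix.mul_apply, Finset.mul_sum]
  refine sum_congr rfl fun p _ => ?_
  rw [← mul_assoc, nodeConductance_mul_networkKernel hcond, networkKernel_apply]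
  ring

/-- **FOSTER'S SECOND IDENTITY (Foster 1961)**: the sum over the pairs of adjacent edges `w ∼ p ∼ q` of
`r(w,q) C_wp C_pq / C_p` is `n − 2` — written as half the sum over ordered triples (the terms with `w = q` vanish,
`r(w,w) = 0`): `½ Σ_p Σ_w Σ_q r(w,q) C_wp C_pq / C_p = n − 2`. [cite: Cinkir2009, §1 («Foster's second identity»),
Cor. 4.3 (`k = 2`, `tr P = 0`); MarkowskyPalacios2016, §2 eq. (foster2)] -/
theorem fosterSecondIdentity [Nontrivial V] (hG : G.Connected) (hc : ∀ e, 0 < c e) :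
    (1 / 2 : ℝ) * ∑ p, ∑ w, ∑ q, effectiveResistance (edgeWeight G c) w q *
        (edgeWeight G c w p * edgeWeight G c p q / nodeConductance (edgeWeight G c) p) =
      (Fintype.card V : ℝ) - 2 := by
  have h := extendedFosterIdentity c hG hc (show 1 ≤ 2 by norm_num)
  rw [show Finset.Ico 1 2 = {1} by rfl, Finset.sum_singleton, pow_one, trace_networkKernel_edgeWeight, add_zero,
    Nat.cast_ofNat] at h
  rw [← h, Finset.sum_comm]
  congr 1
  refine sum_congr rfl fun w _ => ?_
  rw [Finset.sum_comm]
  refine sum_congr rfl fun q _ => ?_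
  rw [mul_right_comm, nodeConductance_mul_networkKernel_sq c hG hc, Finset.sum_mul]
  exact sum_congr rfl fun p _ => mul_comm _ _

/-- **The third identity (Palacios 2004)**, the `k = 3` case of Cor. 4.3 with `tr P = 0` and `tr P²` expanded:
`½ Σ_{i,t} C_i r(i,t) p⁽³⁾_it = n − 3 + Σ_{p,q} C_pq²/(C_p C_q)`. [cite: Cinkir2009, §1 («the third identity due to
Palacios»), Cor. 4.3 (`k = 3`), §4 (third displayed identity)] -/
theorem fosterThirdIdentity [Nontrivial V] (hG : G.Connected) (hc : ∀ e, 0 < c e) :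
    (1 / 2 : ℝ) * ∑ i, ∑ t, nodeConductance (edgeWeight G c) i * effectiveResistance (edgeWeight G c) i t *
        (networkKernel (edgeWeight G c) ^ 3) i t =
      (Fintype.card V : ℝ) - 3 +
        ∑ p, ∑ q, edgeWeight G c p q ^ 2 / (nodeConductance (edgeWeight G c) p * nodeConductance (edgeWeight G c) q) := by
  rw [extendedFosterIdentity c hG hc (show 1 ≤ 3 by norm_num), show Finset.Ico 1 3 = {1, 2} by rfl,
    Finset.sum_pair (by norm_num), pow_one, trace_networkKernel_edgeWeight, zero_add, trace_networkKernel_sq,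
    Nat.cast_ofNat]

end Network

/-! ## §5′ Simple graphs with unit resistances (Markowsky–Palacios §2) -/

section SimpleGraph

variable {V : Type*} [Fintype V] [DecidableEq V] {G : SimpleGraph V} [DecidableRel G.Adj]

/-- **Theorem 1 (Foster's `r`-th theorem, unit resistances), matrix form**: for a connected graph on `n ≥ 2`
vertices, `Σ_i Σ_j deg(i) (Pʳ)_ij R_ij = 2(Σ_{s=0}^{r−1} tr(Pˢ) − r)`, `P` the simple random walk; here
`deg(i)(Pʳ)_ij = Σ_{j ∼ v_{r−1} ∼ ⋯ ∼ v_1 ∼ i} 1/(deg(v_1)⋯deg(v_{r−1}))` is the printed path weight. [cite: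
MarkowskyPalacios2016, §2 Thm. 1] -/
theorem MarkowskyPalacios2016_thm_1 [Nontrivial V] (hG : G.Connected) (r : ℕ) :
    ∑ i, ∑ j, (G.degree i : ℝ) * (srwKernel G ^ r) i j * effectiveResistance (G.adjMatrix ℝ) i j =
      2 * (∑ s ∈ Finset.range r, (srwKernel G ^ s).trace - r) := by
  have h := extendedFosterIdentity_range (G := G) (fun _ => (1 : ℝ)) hG (fun _ => one_pos) r
  rw [edgeWeight_one_eq_adjMatrix, networkKernel_adjMatrix] at h
  rw [← h, ← mul_assoc, show (2 : ℝ) * (1 / 2) = 1 by norm_num, one_mul]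
  refine sum_congr rfl fun i _ => sum_congr rfl fun j _ => ?_
  rw [nodeConductance_adjMatrix]
  ring

/-- **(foster1), Foster's first theorem with every resistance counted twice**: «`Σ_{v∈G} Σ_{y∼v} R_vy = 2(n−1)`»
(connected graph with unit resistances on `n ≥ 2` vertices). [cite: MarkowskyPalacios2016, §2 eq. (foster1)] -/
theorem MarkowskyPalacios2016_foster1 [Nontrivial V] (hG : G.Connected) :
    ∑ v, ∑ y, (if G.Adj v y then effectiveResistance (G.adjMatrix ℝ) v y else 0) =
      2 * ((Fintype.card V : ℝ) - 1) := by
  have h := MarkowskyPalacios2016_thm_1 (G := G) hG 1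
  rw [Finset.range_one, Finset.sum_singleton, pow_zero, trace_one, Nat.cast_one, pow_one] at h
  rw [← h]
  refine sum_congr rfl fun v _ => sum_congr rfl fun y _ => ?_
  rw [← networkKernel_adjMatrix, ← nodeConductance_adjMatrix,
    nodeConductance_mul_networkKernel (isConductance_adjMatrix (degree_pos_of_connected hG)), adjMatrix_apply]
  split_ifs <;> simp

/-- **(foster2), FOSTER'S SECOND THEOREM with every resistance counted twice**: over the paths `x ∼ y ∼ v` of
length two, weighted by `1/deg` of the middle vertex, `Σ_v Σ_y Σ_x [x ∼ y][y ∼ v] R_xv / deg(y) = 2(n − 2)` — Theorem 1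
with `r = 2` («`tr(P⁰) = n` and `tr(P¹) = 0`»). [cite: MarkowskyPalacios2016, §2 eq. (foster2) and Thm. 1 (`r = 2`)] -/
theorem MarkowskyPalacios2016_foster2 [Nontrivial V] (hG : G.Connected) :
    ∑ v, ∑ y, ∑ x, (if G.Adj x y ∧ G.Adj y v then effectiveResistance (G.adjMatrix ℝ) x v / G.degree y else 0) =
      2 * ((Fintype.card V : ℝ) - 2) := by
  have h2 := fosterSecondIdentity (G := G) (fun _ => (1 : ℝ)) hG (fun _ => one_pos)
  rw [edgeWeight_one_eq_adjMatrix] at h2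
  have h2' : ∑ p, ∑ w, ∑ q, effectiveResistance (G.adjMatrix ℝ) w q *
      (G.adjMatrix ℝ w p * G.adjMatrix ℝ p q / nodeConductance (G.adjMatrix ℝ) p) = 2 * ((Fintype.card V : ℝ) - 2) := by
    rw [← h2]
    ring
  rw [← h2', Finset.sum_comm]
  refine sum_congr rfl fun y _ => ?_
  rw [Finset.sum_comm]
  refine sum_congr rfl fun x _ => sum_congr rfl fun v _ => ?_
  rw [nodeConductance_adjMatrix, adjMatrix_apply, adjMatrix_apply]
  by_cases hxy : G.Adj x y <;> by_cases hyv : G.Adj y v <;> simp [hxy, hyv, div_eq_mul_inv]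

end SimpleGraph

end Literature.Probability.MarkovChains
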